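import Summits.QuantumFields.BalabanUV.T4Continuum.Support.NE3CurlPairedResidualScale
import Summits.QuantumFields.BalabanUV.T4Continuum.Support.NE3PureGaugeFirstVariation
import HarnessLib

/-!
# T⁴ programme, node NE3 — (RES♯) PASSES TO A GAUGE QUOTIENT: the curl-paired residual on ANY direction set `T` whose members split as «tangent part in
# `T′` + pure gauge direction» with a k-free weighted-norm bound on the tangent part, from (RES♯) on `T′` (exact gauge invariance of the first variation,
# `NE3PureGaugeFirstVariation.dAction_add_gaugeDir`) — the kernel skeleton of census row R25's (RES♯) on B8's slice `slicB8`

Cell `pub-balaban-gaps` (YM blitz, track G2, seat `ne3`, unit `pub-balaban-gaps-ne3`; writer prover-pub-balaban-gaps-ne3-g2-0, 2026-08-22), repair R3∕R25 of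
`run/shared/lean/pub/pub-balaban-gaps/ne/NE3.md` §4.  WHY.  The END on B8's surface (`Spine/NE3/PairLandauB8End`) asks, per pair, (RES♯)
`CurlPairedResidual L k W (slicB8 L N k W) r F` on B8's tangent slice, whose members are NOT tangent to the plain fibre (`TangentIter`) — they carry a
coarse gauge component — so row R♯5d (`NE3CurlPairedResidualScale.curlPairedResidual_regular_residualScale`, valid on every `T′ ⊆ {skew, periodic,
TangentIter}`) does not apply verbatim.  Since the first variation of the Wilson action vanishes EXACTLY on pure gauge directions (Π-G0,
`dAction_gaugeDir`), (RES♯) on `T` follows from (RES♯) on `T′` as soon as every `Y ∈ T` splits as `Y = Y_t + gaugeDir W ζ` with `Y_t ∈ T′` and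
`‖Y_t‖_w ≤ K·‖Y‖_w` — the TANGENT PROJECTION BOUND, typed here as a hypothesis SHAPE (its k-uniformity at `d = 4` is the located analytic content of R25:
`ξ²·dirSq (gaugeDir W ζ) ≍ N⁴·∣∇ζ_c∣²` and `∣DC_W Y∣ ≲ ‖Y‖_w` are both k-free exactly at `d = 4`, N- and V-dependent through the coarse elliptic constant).

CONTENT (0 sorry): §1 `TangentProjectionBound L k W T T′ K F` (hypothesis SHAPE) with `tangentProjectionBound_of_subset` (non-vacuity: `T ⊆ T′`, `K = 1`,
`ζ = 0`); §2 **`curlPairedResidual_of_tangentProjection`**: (RES♯) on `T′` with `r ≥ 0` ∧ the projection bound with constant `K` ⟹ (RES♯) on `T` with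
`K·r`; §3 **`curlPairedResidual_sfClass_of_tangentProjection`** — over `sfClass` at the background `cavg L U_B` of a `(b,g)`-regular run-B minimiser, for ANY
direction set `T` with the projection bound onto the tangent directions `{skew ∧ periodic ∧ TangentIter L j (cavg L U_B)}`: (RES♯) on `T` with
`K·C′_{R♯5d}·residualScale d L N b g (j+1)` (R♯5d BY NAME).

HONEST FRAMING.  Kernel bookkeeping; `TangentProjectionBound` is a hypothesis SHAPE asserted for nothing except the trivial inclusion case; (RES♯) on `slicB8`,
(P♮), the covariant root and **NE3 are NOT proved**; spine PROVED 0∕9; finite T⁴ rung (B)+1 — NOT infinite volume, NOT mass gap, NOT `BetaPertH`, NOT Clay.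
ABSOLUTE RULE kept (context only: [Balaban1985RegularSpaces] (1.29)∕(1.37) pp. 81–82 — B8's representative leaves the plain fibre by a coarse gauge
rotation).  PLACEMENT: `Summits/QuantumFields/BalabanUV/T4Continuum/Support/`; imports accepted modules only; moves nothing.  HONEST DEPENDENCY: continuum
YM on T⁴ ⇐ BetaPertH ∧ nine spine estimates (0/9 proved); BetaPertH ⇐ (D1) ∧ (D4) ∧ CAP+tail; G-an2-4 gates asym, D1 and NE2/3/4.
-/

set_option autoImplicit false

open scoped BigOperators Matrix Matrix.Norms.L2Operator
open NormedSpace Finset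

namespace Summit.QuantumFields.BalabanUV.T4Continuum.NE3CurlPairedResidualGaugeQuotient

open Literature.MathematicalPhysics.QuantumFieldTheory.Balaban1983to89
open B7Prop1Explicit B7Prop2Explicit
open T4AveragingDeficitWall hiding Site Plane Plaq Bond
open T4AveragingDeficitWallBoundary (periodBox)
open AveragingDeficitPeriodicCounting (IsPeriodicDir)
open AveragingDeficitChartCalculus (cavg)
open AveragingDeficitMultiLevelPrep (LevelSmall TangentIter)
open MinimalActionSandwich (IsMinimiser)
open MinimalActionRate (Regular sfClass)
open NE3EnergyShapes (residualScale residualScale_nonneg)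
open NE3EnergyWeightedShapes (energyNormW energyNormW_nonneg CurlPairedResidual)
open NE3HessForm (dAction)
open BlockAveragePushDirGauge (gaugeDir)
open NE3PureGaugeFirstVariation (dAction_add_gaugeDir)
open NE3CurlPairedResidualScale (curlPairedResidual_regular_residualScale)

noncomputable section

variable {d : ℕ} {n : Type*} [Fintype n] [DecidableEq n]

/-! ## §1 The tangent projection bound (hypothesis SHAPE) -/

/-- **THE TANGENT PROJECTION BOUND** at the background `W`, from the direction set `T` onto the direction set `T′` ALONG PURE GAUGE DIRECTIONS, with constant
`K`, in the weighted norm of level `k` over the site set `F`: every `Y ∈ T` splits as `Y = Y_t + gaugeDir W ζ` with `Y_t ∈ T′` and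
`energyNormW L k W Y_t F ≤ K·energyNormW L k W Y F`.  For `T = slicB8(W)` (B8's slice) and `T′` = the plain-fibre tangent directions this is the located
analytic half of census row R25 (k-free exactly at `d = 4`).  A hypothesis SHAPE, asserted for nothing except the inclusion case below. [folklore] -/
@[folklore]
def TangentProjectionBound (L k : ℕ) (W : Site d → Fin d → (Matrix n n ℂ)ˣ) (T T' : Set (Site d → Fin d → Matrix n n ℂ)) (K : ℝ)
    (F : Finset (Site d)) : Prop :=
  ∀ Y ∈ T, ∃ (Yt : Site d → Fin d → Matrix n n ℂ) (ζ : Site d → Matrix n n ℂ),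
    Yt ∈ T' ∧ Y = Yt + gaugeDir W ζ ∧ energyNormW L k W Yt F ≤ K * energyNormW L k W Y F

/-- `gaugeDir W 0 = 0`. [folklore] -/
theorem gaugeDir_zero (W : Site d → Fin d → (Matrix n n ℂ)ˣ) : gaugeDir W (fun _ => (0 : Matrix n n ℂ)) = 0 := by
  funext x μ
  simp [gaugeDir, Ad]

/-- NON-VACUITY: if `T ⊆ T′` the projection bound holds with `K = 1` (`Y_t = Y`, `ζ = 0`). [folklore] -/
theorem tangentProjectionBound_of_subset (L k : ℕ) (W : Site d → Fin d → (Matrix n n ℂ)ˣ) {T T' : Set (Site d → Fin d → Matrix n n ℂ)}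
    (h : T ⊆ T') (F : Finset (Site d)) : TangentProjectionBound L k W T T' 1 F := by
  intro Y hY
  refine ⟨Y, fun _ => 0, h hY, ?_, by rw [one_mul]⟩
  rw [gaugeDir_zero, add_zero]

/-! ## §2 (RES♯) passes to the gauge quotient -/

/-- **(RES♯) ON `T` FROM (RES♯) ON `T′` AND THE TANGENT PROJECTION BOUND**: `CurlPairedResidual L k W T′ r F` (`r ≥ 0`) and
`TangentProjectionBound L k W T T′ K F` give `CurlPairedResidual L k W T (K·r) F` — for `Y = Y_t + gaugeDir W ζ`, `dAction W Y = dAction W Y_t`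
(`dAction_add_gaugeDir`: the first variation of the Wilson action is blind to pure gauge directions, exactly), and `∣dAction W Y_t∣ ≤ r·‖Y_t‖_w ≤ r·K·‖Y‖_w`.
[folklore] -/
theorem curlPairedResidual_of_tangentProjection {L k : ℕ} {W : Site d → Fin d → (Matrix n n ℂ)ˣ} {T T' : Set (Site d → Fin d → Matrix n n ℂ)}
    {r K : ℝ} {F : Finset (Site d)} (hr : 0 ≤ r) (hres : CurlPairedResidual L k W T' r F) (hproj : TangentProjectionBound L k W T T' K F) :
    CurlPairedResidual L k W T (K * r) F := by
  intro Y hY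
  obtain ⟨Yt, ζ, hYt, hsplit, hbound⟩ := hproj Y hY
  rw [hsplit, dAction_add_gaugeDir, ← hsplit]
  calc |dAction W Yt (F ×ˢ Finset.univ)| ≤ r * energyNormW L k W Yt F := hres Yt hYt
    _ ≤ r * (K * energyNormW L k W Y F) := mul_le_mul_of_nonneg_left hbound hr
    _ = K * r * energyNormW L k W Y F := by ring

/-! ## §3 Over `sfClass`: (RES♯) on any direction set with a projection bound onto the plain-fibre tangent directions -/

/-- **(RES♯) OVER `sfClass` ON ANY DIRECTION SET WITH A TANGENT PROJECTION BOUND** (`d ≥ 2`, `L, N ≥ 1`, `0 ≤ b < ε`, `g > 0`, levels `j+1`∕`j+2`, row Y9's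
multi-level smallness): at the background `W = cavg L U_B` of a `(b, g)`-regular run-B minimiser of `sfClass d L N ε`, if the direction set `T` has the
projection bound with constant `K` onto `T′ := {Y ∣ skew ∧ (N·L^{j+1})-periodic ∧ TangentIter L j W Y}`, then `CurlPairedResidual L (j+1) W T (K·C′·residualScale d L N b g (j+1))
(periodBox (N·L^{j+1}))` with the LEVEL-FREE `C′` of R♯5d (`curlPairedResidual_regular_residualScale` BY NAME on `T′`).  With `T := slicB8 L N (j+1) W` this is
census R25's (RES♯) modulo the projection bound. [folklore] -/
theorem curlPairedResidual_sfClass_of_tangentProjection [Nonempty n] (hd : 2 ≤ d) {L N : ℕ} [NeZero L] [NeZero N] (hL : 1 ≤ L)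
    (hN : 1 ≤ N) (j : ℕ) {ε b g : ℝ} (hb : 0 ≤ b) (hbε : b < ε) (hg : 0 < g)
    (hsmall : LevelSmall d L (j + 1) (ε / ((L : ℝ) ^ (j + 2)) ^ 2))
    {V UB : Site d → Fin d → (Matrix n n ℂ)ˣ} (hB : IsMinimiser d (sfClass d L N ε) L N (j + 2) V UB)
    (hreg : Regular d L N b g (j + 2) UB) {T : Set (Site d → Fin d → Matrix n n ℂ)} {K : ℝ}
    (hproj : TangentProjectionBound L (j + 1) (cavg L UB) T
      {Y | IsSkewDir Y ∧ IsPeriodicDir Y ((N * L ^ (j + 1) : ℕ) : ℤ) ∧ TangentIter L j (cavg L UB) Y} K (periodBox (N * L ^ (j + 1)))) :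
    CurlPairedResidual L (j + 1) (cavg L UB) T
      (K * ((Real.sqrt ((L : ℝ) ^ (d - 2))
            + (Real.sqrt ((L : ℝ) ^ (d - 2)) * Real.sqrt (8 * Fintype.card (T4AveragingDeficitWall.Plane d))
                * (128 * (d * (L : ℝ) ^ 2))
              + 2 * (2048 * ((d : ℝ) + 4) ^ 2 * (L : ℝ) ^ 2 * Real.sqrt (d * (L : ℝ) ^ d))) * b
            + b ^ 2 * (2 * (L : ℝ) ^ (d - 1) + 2 * (8 * d * (L : ℝ) ^ d)) * Real.sqrt (d / (g * (L : ℝ) ^ (d + 2))))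
        * residualScale d L N b g (j + 1)))
      (periodBox (N * L ^ (j + 1))) := by
  have hT' : ∀ Y ∈ {Y : Site d → Fin d → Matrix n n ℂ | IsSkewDir Y ∧ IsPeriodicDir Y ((N * L ^ (j + 1) : ℕ) : ℤ) ∧ TangentIter L j (cavg L UB) Y},
      IsSkewDir Y ∧ IsPeriodicDir Y ((N * L ^ (j + 1) : ℕ) : ℤ) ∧ TangentIter L j (cavg L UB) Y := fun Y hY => hY
  have hres := curlPairedResidual_regular_residualScale hd hL hN j hb hbε hg hsmall hB hreg hT'
  have hr : 0 ≤ (Real.sqrt ((L : ℝ) ^ (d - 2))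
            + (Real.sqrt ((L : ℝ) ^ (d - 2)) * Real.sqrt (8 * Fintype.card (T4AveragingDeficitWall.Plane d))
                * (128 * (d * (L : ℝ) ^ 2))
              + 2 * (2048 * ((d : ℝ) + 4) ^ 2 * (L : ℝ) ^ 2 * Real.sqrt (d * (L : ℝ) ^ d))) * b
            + b ^ 2 * (2 * (L : ℝ) ^ (d - 1) + 2 * (8 * d * (L : ℝ) ^ d)) * Real.sqrt (d / (g * (L : ℝ) ^ (d + 2))))
        * residualScale d L N b g (j + 1) := by
    have := residualScale_nonneg d L N b g (j + 1)
    positivity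
  exact curlPairedResidual_of_tangentProjection hr hres hproj

end

end Summit.QuantumFields.BalabanUV.T4Continuum.NE3CurlPairedResidualGaugeQuotient
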